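import Summits.QuantumFields.YangMills.Theorems.BalabanUVNodesSpineReadingOfRecord13CoPHKRatioDominationBanked
import Summits.QuantumFields.YangMills.Theorems.BalabanUVNodesN20BankedRecordPriceOfT4Branching

/-!
# N20 (NE7b) ON THE TOWER-FREE ROAD, END TO END WITH THE BANKING BY NAME: at the CoPHK carriers of record, for ANY bad-key reading, the fibrewise letters with good images (a) whose
# factors are dominated by the PRODUCT OF THE RAW FACTORS `e^{−credits}·e^{+lifeCost}` of the removed components' GENEALOGIES (`T4PersistenceDictionary.Gen`), the removal ∕ filing ∕
# labelling data (b), the candidates filed under (birth slot, TREE SHAPE ∈ `T4BranchingRecordsGas.fam`) with fibre multiplicities `≤ M^{partnerAges}` folded into the age factor (the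
# K-UNIFORM count of `pub-balaban`'s branching records — menus, four budgets, side condition displayed) (ID), and ONE `Banking` per level (`T4BankedInduction.Banking` — inhabited from the
# typed flow by `T4PrintedShapeBanking.exists_irThreshold`) ⇒ `RelWeightBound 1 … (K ↦ 1 − exp(−S_K))`, `S_K = ρ̄e^{−κ₁}·V·r^{K − j⋆(K) + 1}∕(1 − r)`, `r = Λ·e^{η̄₊ − κ₁}` — the face
# of ✓p773984 with its (R1) block (event universes, kinds, residuals, entropies, windows, prices, `hfile`, `hy`) REPLACED by genealogy labels, branching menus and a `Banking`

Cell `pub-ymgap`, YM-PLAN Track A (HUMAN RULING D-0062); seat `pub-ymgap-dag-n20-d` (R134 (a) N20 NE7b s3), gen 41 — director-ym №374 line (E), road [e] TOWER-FREE of record (№377).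
`--kind proof --supports stmt-QuantumFields-27366 --as helper` (K3⁸); COUNT-NEUTRAL; THEOREMS ONLY (0 `def`).  [IV] = [Balaban1989LargeFieldI]; [LF-II] = [Balaban1989LargeFieldII].
Companions BY NAME: `…CoPHKRatioDominationBanked.relWeightBound_twoRate_of_fibreDomLetters_banked` (gen 40, p771762), `…N20BankedRecordPriceOfT4Branching.
sum_stock_le_twoRate_of_branchingGenealogies` (gen 41), hence `pub-balaban`'s `T4BankedInduction.{Banking, credits, lifeCost, rawFactor_le_recordPrice}`, `T4BranchingRecordsGas.{fam,
treeWt, bslotPriceT_le, treeShape_of_mulRawShape}`, `T4PartnerMultiplicity.{partnerAges, windowSurplus}` and `T4PersistenceDictionary.Gen`.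

WHY.  ✓p773984 `relWeightBound_records_of_fibreDomLetters_banked` displayed, per run and per `(K, t)`, a 14-object ∕ 14-clause package whose second half was «(R1) the per-record prices
— the cell's BANKING of print's credits» in print's variable-window currency.  Gen 41's READING NOTE (bus 13:33Z): the cell `pub-balaban` carries that banking END TO END on its (ID)
genealogy ledger — arithmetic (`T4BankedInduction.banked_induction`, exponentiated `rawFactor_le_recordPrice`) AND pay side (`T4PrintedShapeBanking.exists_irThreshold`: print's cost ∕
credit shapes inhabit `Banking` along any run of the typed (2.5) ∕ (2.7) ∕ (2.9) past ONE infrared threshold).  p775278 struck (R1) from the stock budget BY NAME, and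
`…OfT4Branching` made the count MULTIPLICITY-TOLERANT and K-uniform (candidates filed by tree shape; a fibre's multiplicity `≤ M^{partnerAges}` folds into the age factor `θ = M·e^{−κ₁}` of
`treeWt`, no smallness of `M`; `T4PartnerMultiplicity`'s located point).  THIS FILE docks that at the carriers of record: the same face as ✓p773984 with, per run, the candidates
`Y ∈ Old σ` CARRYING admissible well-formed genealogies `G Y` pending at the run's level with partner ages below the window surplus, in the menus' family `fam Lren Lmer Lpart n (Lb j) j level`
of their birth step `j = (slot Y).1`, at most `M^{partnerAges st (G Y)}` candidates per (slot, genealogy), menu budgets `Σ_{Lb j} e^{−(reserve b + E b)} ≤ ρ̄`, `Σ_{Lren t} e^{−E e} ≤ a`,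
`Σ_{Lmer t} e^{−E e} ≤ μ`, `Σ_{Lpart s} e^{−E b} ≤ ν`, the age datum `M·e^{−κ₁}·e^{η̄₊} < 1` with the fixed-point side condition, the activities INSTANTIATED
`x Y := e^{−credits(G Y)}·e^{+lifeCost(G Y)}` (so the letter's factor clause reads `z s ≤ Π_{Y ∈ φ σ s} rawFactor(G Y)`), and ONE `Banking` per level with banks `κ₁·W + E` as a displayed
hypothesis `hB` — the node owners of (B) inhabit it through `T4PrintedShapeBanking.exists_irThreshold` along the run of record.

WHAT IS PROVED.  ★★★ `relWeightBound_branchingGenealogies_of_fibreDomLetters` (run A at level `K₀ + K` with cut `K₀ + j⋆(K)`, run B at `K₀ + K + 1` with cut `K₀ + j⋆(K) + 1` give the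
SAME `S_K` (`omega`); `relWeightBound_twoRate_of_fibreDomLetters_banked` ∘ `sum_stock_le_twoRate_of_branchingGenealogies`).

HONEST FRAMING.  [bookkeeping].  Displayed hypotheses, each NOT PRINTED as a theorem of [LF-II] for `d = 4` and NOT proved here: (a) the fibrewise letters with their factor clause on the
genealogy ledger (an ESTIMATE; junction NC-NE7b-α UNRULED — [LF-II] (1.79) p. 383 «holds for all large field regions» + (1.89)⁺ p. 387 READ on [IV] (0.3)'s fibre ratio); (b) removal maps
with good images, fibre injections, slot filing AND the genealogy labels `G` with their admissibility ∕ well-formedness ∕ pendency (a DEFINER object on def-T's index — post-campaign design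
memo per №374 — = `pub-balaban`'s READING (ID)-a∕b∕c + R3′); (ID) the menus, their budgets `ρ̄, a, μ, ν`, the side condition, the family memberships and the fibre multiplicities `M^{partnerAges}` (partners' birth cells), the cells `V·Λ^a` (p774413
on the torus); (B) the `Banking` per
level (`exists_irThreshold`: typed flow + infrared smallness — the node owners').  The per-case pay inequalities of print and the banked induction are NOT hypotheses any more
(`T4BankedInduction` ∕ `T4PrintedShapeBanking` by name through p775278).  NO weight of Bałaban's is bounded, NO estimate proved; NE7 ∕ NE7b ∕ NE7c NOT PRINTED ∕ NOT proved; no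
`Provisos₁₃CoPH` inhabitant claimed (K0⁷ OPEN); K3⁸ untouched; N20 NOT discharged; counts UNMOVED (typed 28∕28 · discharged 8∕27); one finite four-torus programme at fixed `ε` — NOT ℝ⁴,
NOT OS, NOT a mass gap, NOT the Clay problem.  No `def`, no `instance`, no `notation`, no `sorry`; no decl below carries a cite tag.

NOTE.  A records-as-SETS twin of this face (labels + `sum_stock_le_twoRate_of_bankedGenealogies`, multiplicity `n_b·Π n_e`) was drafted and NOT filed: its multiplicity binder is not
K-uniformly dischargeable for the partners' birth cells (`T4PartnerMultiplicity`; the seat's memo `N20-R1-STRUCK.g41.md`, evidence on stmt-QuantumFields-27366); this branching face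
supersedes it.
-/

noncomputable section

open MeasureTheory
open scoped BigOperators
open Finset

namespace YMDAG.UVSplit

open Literature.MathematicalPhysics.QuantumFieldTheory.Balaban1983to89
open Literature.MathematicalPhysics.QuantumFieldTheory.Balaban1983to89.T4Continuum
open Literature.MathematicalPhysics.QuantumFieldTheory.Balaban1983to89.Node00
open Literature.MathematicalPhysics.QuantumFieldTheory.Balaban1983to89.B15.BasicStep (fibreIntegral)
open T4WeightBudget (RelWeightBound)
open T4PersistenceDictionary (Gen)
open T4BankedInduction (Banking credits lifeCost)
open T4PartnerMultiplicity (partnerAges windowSurplus)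
open T4BranchingRecordsGas (fam)

variable {F : T4Family} {N : ℕ} [NeZero N]

section Face

variable (θ : Stage13HParams F N) (hP : θ.Provisos₁₃CoPH F N) (K₀ : ℕ) (g₀ : ℕ → ℝ) (os : List (ULoop F))
  (kr : ℕ → (Σ K, SiteSeqKey F (K₀ + K)) → (Σ K, SiteSeqKey F (K₀ + K))) (bd : ℕ → (Σ K, SiteSeqKey F (K₀ + K)) → Prop)

open scoped Classical in
/-- ★★★ **THE N20 FACE ON THE TOWER-FREE ROAD WITH THE BANKING AND THE BRANCHING COUNT BY NAME** (any bad-key reading `bd`; constants `V ≥ 0`, `Λ > 0`, `κ₁ ≥ 0`, `ρ̄ ≥ 0`, `η̄₊ ≥ 0`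
with the root rate `Λ·e^{η̄₊−κ₁} < 1`, an age datum `M ≥ 0` with `M·e^{−κ₁}·e^{η̄₊} < 1` and the menus' side condition for the budgets `a, μ, ν`, a cut `j⋆(K) ≤ K` with `c·K ≤ K − j⋆(K)`,
cells `#Cell a ≤ V·Λ^a`; level-indexed banking data with ONE `Banking` per level, banks `κ₁·W + Emg`; a step map `st` on the labels; per `(K, t)`, `|t| ≤ 1`, EACH RUN: removal map with
good images, fibre sets, factors with the fibrewise letter on the bad-key histories and the factor clause `z s ≤ Π_{Y ∈ φ σ s} e^{−credits(G Y)}·e^{+lifeCost(G Y)}`, stocks with fibre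
injections, birth slots older than the run's cut in cells, menus `Lren`, `Lmer` (labels at their step), `Lpart`, `Lb`, fuel `n` with the four budgets in the weights `e^{−(reserve+Emg)}` ∕
`e^{−Emg}`, genealogy labels admissible ∕ well-formed ∕ pending at the run's level ∕ partner ages below the window surplus ∕ in the family `fam … n (Lb j) j level` of their slot's step,
fibre multiplicities `#fibre(slot, G) ≤ M^{partnerAges st G}`; displayed measurability ∕ integrability) ⇒ `RelWeightBound 1 (classSetK₁₃ …) (weightAK₁₃ …) (weightBK₁₃ …)
(badClassK₁₃ … bd) (K ↦ 1 − exp(−S_K))`, `S_K = ρ̄e^{−κ₁}·V·r^{K − j⋆(K) + 1}∕(1 − r)`, `r = Λ·e^{η̄₊−κ₁}`. [bookkeeping] -/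
theorem relWeightBound_branchingGenealogies_of_fibreDomLetters {X γ ε : Type*} [DecidableEq γ] [DecidableEq ε] {V Λ κ₁ ρbar ηplus a μ ν M c : ℝ} (hV : 0 ≤ V) (hΛ : 0 < Λ)
    (hκ : 0 ≤ κ₁) (hρbar : 0 ≤ ρbar) (hηplus : 0 ≤ ηplus) (hM : 0 ≤ M) (hr : Λ * Real.exp (ηplus - κ₁) < 1) (h1 : M * Real.exp (-κ₁) * Real.exp ηplus < 1)
    (hside : (a + μ * ν * (M * Real.exp (-κ₁) / (1 - M * Real.exp (-κ₁) * Real.exp ηplus))) * Real.exp ηplus ≤ Real.exp ηplus - 1)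
    (hc : 0 < c) {jstar : ℕ → ℕ} (hjK : ∀ K, jstar K ≤ K)
    (hfrac : ∀ K : ℕ, c * K ≤ ((K - jstar K : ℕ) : ℝ)) (Cell : ℕ → Finset γ) (hcell : ∀ a, ((Cell a).card : ℝ) ≤ V * Λ ^ a)
    {adm : ℕ → Gen ε → Prop} {W : ℕ → ε → ℕ} {cost : ℕ → Gen ε → ℕ → ℝ} {credit Emg reserve : ℕ → ε → ℝ} {ext : ℕ → Gen ε → Gen ε → ε → ℝ}
    (hB : ∀ l, Banking (adm l) (W l) (cost l) (credit l) (fun e => κ₁ * (W l e : ℝ) + Emg l e) (reserve l) (ext l)) (st : ε → ℕ)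
    (hmA : ∀ K t s, Measurable fun V => chiSeqOfRecord F N θ.ν θ.τ9.M (histA₁₃ θ K₀ g₀ K) (K₀ + K) (K₀ + K) s V *
      dressedSlotsOfDatum₉ F N θ.toStage9Params (datumOfRecord₁₃CoPH F N θ hP) g₀ os t (runA₁₃ F K₀ g₀ K) (histA₁₃ θ K₀ g₀ K) (K₀ + K) s V)
    (hintA : ∀ K t s, Integrable (fun V => chiSeqOfRecord F N θ.ν θ.τ9.M (histA₁₃ θ K₀ g₀ K) (K₀ + K) (K₀ + K) s V *
      dressedSlotsOfDatum₉ F N θ.toStage9Params (datumOfRecord₁₃CoPH F N θ hP) g₀ os t (runA₁₃ F K₀ g₀ K) (histA₁₃ θ K₀ g₀ K) (K₀ + K) s V)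
      (fieldMeasure (F.P (K₀ + K)) (K₀ + K) (SU N)))
    (hmB : ∀ K t s', Measurable fun V => chiSeqOfRecord F N θ.ν θ.τ9.M (histB₁₃ θ K₀ g₀ K) (K₀ + K + 1) (K₀ + K + 1) s' V *
      dressedSlotsOfDatum₉ F N θ.toStage9Params (datumOfRecord₁₃CoPH F N θ hP) g₀ os t (runB₁₃ F K₀ g₀ K) (histB₁₃ θ K₀ g₀ K) (K₀ + K + 1) s' V)
    (hintB : ∀ K t s', Integrable (fun V => chiSeqOfRecord F N θ.ν θ.τ9.M (histB₁₃ θ K₀ g₀ K) (K₀ + K + 1) (K₀ + K + 1) s' V *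
      dressedSlotsOfDatum₉ F N θ.toStage9Params (datumOfRecord₁₃CoPH F N θ hP) g₀ os t (runB₁₃ F K₀ g₀ K) (histB₁₃ θ K₀ g₀ K) (K₀ + K + 1) s' V)
      (fieldMeasure (F.P (K₀ + K + 1)) (K₀ + K + 1) (SU N)))
    (hLA : ∀ (K : ℕ) (t : ℝ), |t| ≤ 1 →
      ∃ (rm : SeqOfRecord F θ.ν θ.τ9.M (histA₁₃ θ K₀ g₀ K) (K₀ + K) (K₀ + K) → SeqOfRecord F θ.ν θ.τ9.M (histA₁₃ θ K₀ g₀ K) (K₀ + K) (K₀ + K))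
        (fib : SeqOfRecord F θ.ν θ.τ9.M (histA₁₃ θ K₀ g₀ K) (K₀ + K) (K₀ + K) → Finset (PBond (F.P (K₀ + K)) (K₀ + K)))
        (z : SeqOfRecord F θ.ν θ.τ9.M (histA₁₃ θ K₀ g₀ K) (K₀ + K) (K₀ + K) → ℝ) (Old : SeqOfRecord F θ.ν θ.τ9.M (histA₁₃ θ K₀ g₀ K) (K₀ + K) (K₀ + K) → Finset X)
        (φ : SeqOfRecord F θ.ν θ.τ9.M (histA₁₃ θ K₀ g₀ K) (K₀ + K) (K₀ + K) → SeqOfRecord F θ.ν θ.τ9.M (histA₁₃ θ K₀ g₀ K) (K₀ + K) (K₀ + K) → Finset X)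
        (slot : X → (Σ _ : ℕ, γ)) (G : X → Gen ε) (Lren Lmer Lpart Lb : ℕ → Finset ε) (n : ℕ),
        (∀ s, kr K (keyA₁₃ θ K₀ g₀ K s) ∈ badClassK₁₃ θ K₀ g₀ kr bd K t → ∀ V,
          fibreIntegral (fib s) (fun V => chiSeqOfRecord F N θ.ν θ.τ9.M (histA₁₃ θ K₀ g₀ K) (K₀ + K) (K₀ + K) s V *
              dressedSlotsOfDatum₉ F N θ.toStage9Params (datumOfRecord₁₃CoPH F N θ hP) g₀ os t (runA₁₃ F K₀ g₀ K) (histA₁₃ θ K₀ g₀ K) (K₀ + K) s V) V ≤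
            z s * fibreIntegral (fib s) (fun V => chiSeqOfRecord F N θ.ν θ.τ9.M (histA₁₃ θ K₀ g₀ K) (K₀ + K) (K₀ + K) (rm s) V *
              dressedSlotsOfDatum₉ F N θ.toStage9Params (datumOfRecord₁₃CoPH F N θ hP) g₀ os t (runA₁₃ F K₀ g₀ K) (histA₁₃ θ K₀ g₀ K) (K₀ + K) (rm s) V) V) ∧
        (∀ s, kr K (keyA₁₃ θ K₀ g₀ K s) ∈ badClassK₁₃ θ K₀ g₀ kr bd K t → kr K (keyA₁₃ θ K₀ g₀ K (rm s)) ∉ badClassK₁₃ θ K₀ g₀ kr bd K t) ∧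
        (∀ σ s, kr K (keyA₁₃ θ K₀ g₀ K s) ∈ badClassK₁₃ θ K₀ g₀ kr bd K t → rm s = σ → φ σ s ⊆ Old σ ∧ (φ σ s).Nonempty) ∧
        (∀ σ, Set.InjOn (φ σ) {s | kr K (keyA₁₃ θ K₀ g₀ K s) ∈ badClassK₁₃ θ K₀ g₀ kr bd K t ∧ rm s = σ}) ∧
        (∀ σ s, kr K (keyA₁₃ θ K₀ g₀ K s) ∈ badClassK₁₃ θ K₀ g₀ kr bd K t → rm s = σ →
          z s ≤ ∏ Y ∈ φ σ s, Real.exp (-credits (credit (K₀ + K)) (G Y)) * Real.exp (lifeCost (W (K₀ + K)) (cost (K₀ + K)) (G Y))) ∧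
        (∀ σ, ∀ Y ∈ Old σ, (slot Y).1 < K₀ + jstar K) ∧ (∀ σ, ∀ Y ∈ Old σ, (slot Y).2 ∈ Cell ((K₀ + K) - (slot Y).1)) ∧
        (∀ t, ∀ e ∈ Lmer t, st e = t) ∧ (∀ t, ∑ e ∈ Lren t, Real.exp (-Emg (K₀ + K) e) ≤ a) ∧ (∀ t, ∑ e ∈ Lmer t, Real.exp (-Emg (K₀ + K) e) ≤ μ) ∧
        (∀ s₀, ∑ b ∈ Lpart s₀, Real.exp (-Emg (K₀ + K) b) ≤ ν) ∧ (∀ j, ∑ b ∈ Lb j, Real.exp (-(reserve (K₀ + K) b + Emg (K₀ + K) b)) ≤ ρbar) ∧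
        (∀ σ, ∀ Y ∈ Old σ, adm (K₀ + K) (G Y)) ∧ (∀ σ, ∀ Y ∈ Old σ, (G Y).WF (W (K₀ + K))) ∧ (∀ σ, ∀ Y ∈ Old σ, K₀ + K < (G Y).reach (W (K₀ + K))) ∧
        (∀ σ, ∀ Y ∈ Old σ, partnerAges st (G Y) ≤ windowSurplus (W (K₀ + K)) (G Y)) ∧
        (∀ σ, ∀ Y ∈ Old σ, G Y ∈ fam Lren Lmer Lpart n (Lb (slot Y).1) (slot Y).1 (K₀ + K)) ∧
        (∀ σ, ∀ j < K₀ + jstar K, ∀ zc ∈ Cell ((K₀ + K) - j), ∀ G₀ ∈ fam Lren Lmer Lpart n (Lb j) j (K₀ + K),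
          ((((Old σ).filter fun Y => slot Y = ⟨j, zc⟩ ∧ G Y = G₀).card : ℕ) : ℝ) ≤ M ^ partnerAges st G₀))
    (hLB : ∀ (K : ℕ) (t : ℝ), |t| ≤ 1 →
      ∃ (rm : SeqOfRecord F θ.ν θ.τ9.M (histB₁₃ θ K₀ g₀ K) (K₀ + K + 1) (K₀ + K + 1) → SeqOfRecord F θ.ν θ.τ9.M (histB₁₃ θ K₀ g₀ K) (K₀ + K + 1) (K₀ + K + 1))
        (fib : SeqOfRecord F θ.ν θ.τ9.M (histB₁₃ θ K₀ g₀ K) (K₀ + K + 1) (K₀ + K + 1) → Finset (PBond (F.P (K₀ + K + 1)) (K₀ + K + 1)))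
        (z : SeqOfRecord F θ.ν θ.τ9.M (histB₁₃ θ K₀ g₀ K) (K₀ + K + 1) (K₀ + K + 1) → ℝ) (Old : SeqOfRecord F θ.ν θ.τ9.M (histB₁₃ θ K₀ g₀ K) (K₀ + K + 1) (K₀ + K + 1) → Finset X)
        (φ : SeqOfRecord F θ.ν θ.τ9.M (histB₁₃ θ K₀ g₀ K) (K₀ + K + 1) (K₀ + K + 1) → SeqOfRecord F θ.ν θ.τ9.M (histB₁₃ θ K₀ g₀ K) (K₀ + K + 1) (K₀ + K + 1) → Finset X)
        (slot : X → (Σ _ : ℕ, γ)) (G : X → Gen ε) (Lren Lmer Lpart Lb : ℕ → Finset ε) (n : ℕ),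
        (∀ s', kr K (keyB₁₃ θ K₀ g₀ K s') ∈ badClassK₁₃ θ K₀ g₀ kr bd K t → ∀ V,
          fibreIntegral (fib s') (fun V => chiSeqOfRecord F N θ.ν θ.τ9.M (histB₁₃ θ K₀ g₀ K) (K₀ + K + 1) (K₀ + K + 1) s' V *
              dressedSlotsOfDatum₉ F N θ.toStage9Params (datumOfRecord₁₃CoPH F N θ hP) g₀ os t (runB₁₃ F K₀ g₀ K) (histB₁₃ θ K₀ g₀ K) (K₀ + K + 1) s' V) V ≤
            z s' * fibreIntegral (fib s') (fun V => chiSeqOfRecord F N θ.ν θ.τ9.M (histB₁₃ θ K₀ g₀ K) (K₀ + K + 1) (K₀ + K + 1) (rm s') V *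
              dressedSlotsOfDatum₉ F N θ.toStage9Params (datumOfRecord₁₃CoPH F N θ hP) g₀ os t (runB₁₃ F K₀ g₀ K) (histB₁₃ θ K₀ g₀ K) (K₀ + K + 1) (rm s') V) V) ∧
        (∀ s', kr K (keyB₁₃ θ K₀ g₀ K s') ∈ badClassK₁₃ θ K₀ g₀ kr bd K t → kr K (keyB₁₃ θ K₀ g₀ K (rm s')) ∉ badClassK₁₃ θ K₀ g₀ kr bd K t) ∧
        (∀ σ s', kr K (keyB₁₃ θ K₀ g₀ K s') ∈ badClassK₁₃ θ K₀ g₀ kr bd K t → rm s' = σ → φ σ s' ⊆ Old σ ∧ (φ σ s').Nonempty) ∧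
        (∀ σ, Set.InjOn (φ σ) {s' | kr K (keyB₁₃ θ K₀ g₀ K s') ∈ badClassK₁₃ θ K₀ g₀ kr bd K t ∧ rm s' = σ}) ∧
        (∀ σ s', kr K (keyB₁₃ θ K₀ g₀ K s') ∈ badClassK₁₃ θ K₀ g₀ kr bd K t → rm s' = σ →
          z s' ≤ ∏ Y ∈ φ σ s', Real.exp (-credits (credit (K₀ + K + 1)) (G Y)) * Real.exp (lifeCost (W (K₀ + K + 1)) (cost (K₀ + K + 1)) (G Y))) ∧
        (∀ σ, ∀ Y ∈ Old σ, (slot Y).1 < K₀ + jstar K + 1) ∧ (∀ σ, ∀ Y ∈ Old σ, (slot Y).2 ∈ Cell ((K₀ + K + 1) - (slot Y).1)) ∧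
        (∀ t, ∀ e ∈ Lmer t, st e = t) ∧ (∀ t, ∑ e ∈ Lren t, Real.exp (-Emg (K₀ + K + 1) e) ≤ a) ∧ (∀ t, ∑ e ∈ Lmer t, Real.exp (-Emg (K₀ + K + 1) e) ≤ μ) ∧
        (∀ s₀, ∑ b ∈ Lpart s₀, Real.exp (-Emg (K₀ + K + 1) b) ≤ ν) ∧ (∀ j, ∑ b ∈ Lb j, Real.exp (-(reserve (K₀ + K + 1) b + Emg (K₀ + K + 1) b)) ≤ ρbar) ∧
        (∀ σ, ∀ Y ∈ Old σ, adm (K₀ + K + 1) (G Y)) ∧ (∀ σ, ∀ Y ∈ Old σ, (G Y).WF (W (K₀ + K + 1))) ∧ (∀ σ, ∀ Y ∈ Old σ, K₀ + K + 1 < (G Y).reach (W (K₀ + K + 1))) ∧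
        (∀ σ, ∀ Y ∈ Old σ, partnerAges st (G Y) ≤ windowSurplus (W (K₀ + K + 1)) (G Y)) ∧
        (∀ σ, ∀ Y ∈ Old σ, G Y ∈ fam Lren Lmer Lpart n (Lb (slot Y).1) (slot Y).1 (K₀ + K + 1)) ∧
        (∀ σ, ∀ j < K₀ + jstar K + 1, ∀ zc ∈ Cell ((K₀ + K + 1) - j), ∀ G₀ ∈ fam Lren Lmer Lpart n (Lb j) j (K₀ + K + 1),
          ((((Old σ).filter fun Y => slot Y = ⟨j, zc⟩ ∧ G Y = G₀).card : ℕ) : ℝ) ≤ M ^ partnerAges st G₀)) :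
    RelWeightBound 1 (classSetK₁₃ θ K₀ g₀ kr) (weightAK₁₃ θ hP K₀ g₀ os kr) (weightBK₁₃ θ hP K₀ g₀ os kr) (badClassK₁₃ θ K₀ g₀ kr bd)
      (fun K => 1 - Real.exp (-(ρbar * Real.exp (-κ₁) * V *
        ((Λ * Real.exp (ηplus - κ₁)) ^ (K - jstar K + 1) / (1 - Λ * Real.exp (ηplus - κ₁)))))) := by
  have hr0 : 0 < Λ * Real.exp (ηplus - κ₁) := mul_pos hΛ (Real.exp_pos _)
  have hC : 0 ≤ ρbar * Real.exp (-κ₁) := mul_nonneg hρbar (Real.exp_pos _).le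
  have hx0 : ∀ (l : ℕ) (G : X → Gen ε) (Y : X), 0 ≤ Real.exp (-credits (credit l) (G Y)) * Real.exp (lifeCost (W l) (cost l) (G Y)) :=
    fun l G Y => (mul_pos (Real.exp_pos _) (Real.exp_pos _)).le
  refine relWeightBound_twoRate_of_fibreDomLetters_banked (X := X) θ hP K₀ g₀ os kr bd hC hV hr0 hr hc hfrac hmA hintA hmB hintB ?_ ?_
  · intro K t ht
    obtain ⟨rm, fib, z, Old, φ, slot, G, Lren, Lmer, Lpart, Lb, n, hDom, hgood, hφ, hinj, hz, hold, hmem, hst, ha, hμ, hν, hρb, hadm, hwf, hpend, hsur, hfam, hcard⟩ :=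
      hLA K t ht
    refine ⟨rm, fib, z, Old, φ, fun Y => Real.exp (-credits (credit (K₀ + K)) (G Y)) * Real.exp (lifeCost (W (K₀ + K)) (cost (K₀ + K)) (G Y)), hDom, hgood,
      fun σ Y _ => hx0 (K₀ + K) G Y, hφ, hinj, hz, fun σ => ?_⟩
    have h := sum_stock_le_twoRate_of_branchingGenealogies (Old σ) slot G
      (fun Y => Real.exp (-credits (credit (K₀ + K)) (G Y)) * Real.exp (lifeCost (W (K₀ + K)) (cost (K₀ + K)) (G Y))) Cell hV hΛ.le hcell hκ (hB (K₀ + K)) Lren Lmer Lpart st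
      hst hM hηplus ha hμ hν h1 hside n Lb hρbar hρb hr (show K₀ + jstar K ≤ K₀ + K from Nat.add_le_add_left (hjK K) K₀) (hold σ) (hmem σ) (hadm σ) (hwf σ) (hpend σ)
      (hsur σ) (hfam σ) (fun Y _ => le_rfl) (hcard σ)
    rw [show K₀ + K - (K₀ + jstar K) = K - jstar K by omega] at h
    exact h
  · intro K t ht
    obtain ⟨rm, fib, z, Old, φ, slot, G, Lren, Lmer, Lpart, Lb, n, hDom, hgood, hφ, hinj, hz, hold, hmem, hst, ha, hμ, hν, hρb, hadm, hwf, hpend, hsur, hfam, hcard⟩ :=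
      hLB K t ht
    refine ⟨rm, fib, z, Old, φ, fun Y => Real.exp (-credits (credit (K₀ + K + 1)) (G Y)) * Real.exp (lifeCost (W (K₀ + K + 1)) (cost (K₀ + K + 1)) (G Y)), hDom, hgood,
      fun σ Y _ => hx0 (K₀ + K + 1) G Y, hφ, hinj, hz, fun σ => ?_⟩
    have h := sum_stock_le_twoRate_of_branchingGenealogies (Old σ) slot G
      (fun Y => Real.exp (-credits (credit (K₀ + K + 1)) (G Y)) * Real.exp (lifeCost (W (K₀ + K + 1)) (cost (K₀ + K + 1)) (G Y))) Cell hV hΛ.le hcell hκ (hB (K₀ + K + 1))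
      Lren Lmer Lpart st hst hM hηplus ha hμ hν h1 hside n Lb hρbar hρb hr
      (show K₀ + jstar K + 1 ≤ K₀ + K + 1 from Nat.succ_le_succ (Nat.add_le_add_left (hjK K) K₀)) (hold σ) (hmem σ) (hadm σ) (hwf σ) (hpend σ) (hsur σ) (hfam σ)
      (fun Y _ => le_rfl) (hcard σ)
    rw [show K₀ + K + 1 - (K₀ + jstar K + 1) = K - jstar K by omega] at h
    exact h

end Face

end YMDAG.UVSplit
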